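import Literature.Analysis.FluidPDE.LerayHopfConcatenation
import Literature.Analysis.FluidPDE.SuitableWeakCongr
import Literature.Analysis.FluidPDE.JiaSverak2015.Statements
import HarnessLib

/-!
# Global continuation of Leray–Hopf weak solutions: the hypothesis-free reductions

Analysis/FluidPDE support file (proofs only; no new definitions), sequel to
`Literature/Analysis/FluidPDE/LerayHopfConcatenation.lean`. That file proves the continuation property
`IsLerayHopfOn.exists_isGlobalLerayHopf_extension` — on `ℝ³`, with viscosity `ν > 0` and zero force,
every Leray–Hopf weak solution on `[0, T)`, `T > 0`, agrees on `(0, T]` with a GLOBAL Leray–Hopf weak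
solution from the same datum (Leray's existence theorem from the final slice, then concatenation) — and
uses it to discharge the continuation hypothesis `hext` of the two reductions stated in
`HouWangYang2025Nonuniqueness.lean`. Here the remaining `hext`-conditional statements of the tree get
their hypothesis-free forms, and the continuation is applied member by member to a whole family:

* `IsLerayHopfOn.exists_isGlobalLerayHopf_extension_of_memLp` — the continuation property for EVERY
  `T : ℝ` (for `T ≤ 0` the agreement clause `∀ t ∈ (0, T], …` is empty and the statement is Leray's
  existence theorem for the datum); this is, literally, the binder `hext` of
  `JiaSverak2015.lerayHopfNonUniqueness_of_local` and of
  `JiaSverak2015.Setting.lerayHopfNonUniqueness_of_spectralA`, which quantify over all `T`;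
* `JiaSverak2015.continuation_hypothesis` (that binder, proved) and the hypothesis-free joins
  `JiaSverak2015.lerayHopfNonUniqueness_of_local_holds` (the JS15-shaped local conclusion
  `∃ T v₀ u v, 0 < T ∧ JS15Datum v₀ ∧ IsNonUniqLHPair T v₀ u v` ⇒ ns.S19 `LerayHopfNonUniqueness`),
  `JiaSverak2015.energyClassNonUniqueness_of_local` (⇒ `W_E`),
  `JiaSverak2015.Setting.lerayHopfNonUniqueness_of_spectralA_of_leaves` ((A) + the published leaf
  Thm. 5.1 ⇒ ns.S19) and `JiaSverak2015.Setting.lerayHopfNonUniqueness_of_spectralB_of_leaves`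
  ((B) ∧ (4.5) ∧ (4.6) + the published leaf Thm. 5.2 ⇒ ns.S19) — modus ponens over the HYPOTHESIS
  structure `JS15Leaves` exactly as `assembly_A` / `assembly_B`, now without the folklore binder;
* `HouWangYang2025.IsNonuniqueFamily.exists_isGlobalLerayHopf_family` — **globalisation of a
  Hou–Wang–Yang family**: if `(u₀, U)` is a family as in Hou–Wang–Yang 2025, Thm. 1 (members Leray–Hopf
  on `ℝ³ × [0, 1]`, suitable on `(0, 1) × ℝ³`, in the mixed classes `L^s(0,1; L^q)`, pairwise distinct on
  `(0, 1]`), then there is a family `(u₀, W)` with the same properties ALL OF WHOSE MEMBERS ARE GLOBAL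
  Leray–Hopf weak solutions, `W n = U n` on `(0, 1]`: continue each member past `t = 1`; suitability and
  the mixed-norm classes on the slab only see the values on `(0, 1) × ℝ³`
  (`IsSuitableWeakSolutionOn.congr_ae`, `MemLqLp.congr_ae_slice`). So the printed `[0, 1]`-statement and
  its global form ("infinitely many global Leray–Hopf solutions from `u₀`") are equivalent in the tree.

Nothing here asserts that a Hou–Wang–Yang family or a JS15 scenario EXISTS: every statement is an
implication from the corresponding hypothesis (`IsNonuniqueFamily u₀ U`, an unrefereed claim's object;
`JS15Leaves`, the published conditional theorems as a hypothesis structure — see the CAUTION in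
`JiaSverak2015/Statements.lean`: `Setting` is junk-instantiable, the joins are meaningful only for the
`Setting` of the actual operator). ns.S19 `LerayHopfNonUniqueness` stays undischarged.

Sources. The continuation step: J. Leray, Acta Math. 63 (1934), §31 (*Théorème d'existence*, pp. 240–241)
and the remark of D. Albritton, E. Brué, M. Colombo, Ann. of Math. 196 (2022), after Thm. 1.2 ("It is
elementary to extend the distinct solutions to global-in-time Leray–Hopf solutions by modifying the force
after `T` and using Leray's result" — arXiv:2112.03116 p.3; here the force is zero throughout). The
conditional theorems: H. Jia, V. Šverák, J. Funct. Anal. 268 (2015), Thm. 1.3 (p.4), Thm. 5.1–5.2 (p.13)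
(arXiv:1306.2136). The family: T. Y. Hou, Y. Wang, C. Yang, arXiv:2509.25116, Thm. 1 (p.3: "infinitely
many distinct suitable Leray–Hopf solutions"), an unrefereed claim of which nothing is used.

## What is deliberately NOT here

* No new definition, no named fact, no statement about the objects of Hou–Wang–Yang 2025 or about the
  spectral scenarios of Jia–Šverák 2015 beyond the implications listed.
* No `𝕋³` version (the tree's continuation is proved on `ℝ³` only).
-/

noncomputable section

open MeasureTheory TopologicalSpace Set Function Filter Topology
open scoped ENNReal NNReal

namespace Literature.Analysis.FluidPDE

/-! ### The continuation property for every `T` -/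

section Extension

variable {T ν : ℝ} {u : ℝ → EuclideanSpace ℝ (Fin 3) → EuclideanSpace ℝ (Fin 3)}
  {u₀ : EuclideanSpace ℝ (Fin 3) → EuclideanSpace ℝ (Fin 3)}

/-- **Global continuation, every `T`.** For `ν > 0` and a weakly divergence-free datum `u₀ ∈ L²(ℝ³)`,
every Leray–Hopf weak solution `u` of the unforced Navier–Stokes system on `ℝ³ × [0, T)` from `u₀`
agrees on `(0, T]` with a global Leray–Hopf weak solution from `u₀` — for `T > 0` this is
`IsLerayHopfOn.exists_isGlobalLerayHopf_extension`; for `T ≤ 0` the interval `(0, T]` is empty and a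
global solution from `u₀` exists by Leray's existence theorem (`leray_existence_R3_holds`; Leray 1934,
§31, *Théorème d'existence*). This is the form in which the continuation enters as the hypothesis
`hext` of `JiaSverak2015.lerayHopfNonUniqueness_of_local`. [cite: Leray1934, §31] -/
theorem IsLerayHopfOn.exists_isGlobalLerayHopf_extension_of_memLp (hν : 0 < ν)
    (hu₀ : MemLp u₀ 2 volume) (hdiv : IsWeaklyDivFree u₀) (hu : IsLerayHopfOn T ν 0 u₀ u) :
    ∃ w : ℝ → EuclideanSpace ℝ (Fin 3) → EuclideanSpace ℝ (Fin 3),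
      IsGlobalLerayHopf ν 0 u₀ w ∧ ∀ t ∈ Ioc 0 T, w t = u t := by
  rcases lt_or_ge 0 T with hT | hT
  · exact hu.exists_isGlobalLerayHopf_extension hν hT
  · obtain ⟨w, hw⟩ := leray_existence_R3_holds ν hν u₀ hu₀ hdiv
    exact ⟨w, hw, fun t ht => absurd (ht.1.trans_le (ht.2.trans hT)) (lt_irrefl 0)⟩

end Extension

/-! ### Jia–Šverák 2015: the joins without the continuation binder -/

namespace JiaSverak2015

/-- **The continuation hypothesis of the JS15 joins holds** — literally the binder `hext` of
`lerayHopfNonUniqueness_of_local` / `Setting.lerayHopfNonUniqueness_of_spectralA` (viscosity `1`, every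
`T : ℝ`, datum in `L²` and weakly divergence free), by
`IsLerayHopfOn.exists_isGlobalLerayHopf_extension_of_memLp` (Leray 1934, §31; the continuation remark
after Albritton–Brué–Colombo 2022, Thm. 1.2). [cite: AlbrittonBrueColombo2022, remark after Thm. 1.2] -/
theorem continuation_hypothesis :
    ∀ (T : ℝ) (v₀ : EuclideanSpace ℝ (Fin 3) → EuclideanSpace ℝ (Fin 3))
      (u : ℝ → EuclideanSpace ℝ (Fin 3) → EuclideanSpace ℝ (Fin 3)),
      MemLp v₀ 2 volume → IsWeaklyDivFree v₀ → IsLerayHopfOn T 1 0 v₀ u →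
        ∃ w : ℝ → EuclideanSpace ℝ (Fin 3) → EuclideanSpace ℝ (Fin 3),
          IsGlobalLerayHopf 1 0 v₀ w ∧ ∀ t ∈ Ioc 0 T, w t = u t :=
  fun _ _ _ hv₀ hdiv hu => hu.exists_isGlobalLerayHopf_extension_of_memLp one_pos hv₀ hdiv

/-- **The JS15-shaped local conclusion implies ns.S19, unconditionally**: two strict-sense Leray–Hopf
solutions of the unforced system (viscosity `1`) on `ℝ³ × [0, T)`, `T > 0`, from a datum of the JS15
class, differing at some `t ∈ (0, T]` on a set of positive measure, give `LerayHopfNonUniqueness` —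
`lerayHopfNonUniqueness_of_local` with its binder `hext` supplied by `continuation_hypothesis`. (The
conclusion shape is that of Jia–Šverák 2015, Thm. 1.3 p.4 / Thm. 5.1–5.2 p.13; nothing is asserted about
its truth.) [cite: JiaSverak2015, Thm. 5.1–5.2 p.13] -/
theorem lerayHopfNonUniqueness_of_local_holds
    (h : ∃ (T : ℝ) (v₀ : EuclideanSpace ℝ (Fin 3) → EuclideanSpace ℝ (Fin 3))
      (u v : ℝ → EuclideanSpace ℝ (Fin 3) → EuclideanSpace ℝ (Fin 3)),
      0 < T ∧ JS15Datum v₀ ∧ IsNonUniqLHPair T v₀ u v) :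
    LerayHopfNonUniqueness :=
  lerayHopfNonUniqueness_of_local continuation_hypothesis h

/-- … and the energy-class variant `W_E` (`energyClassNonUniqueness_of_lerayHopfNonUniqueness`).
[cite: JiaSverak2015, Thm. 5.1–5.2 p.13] -/
theorem energyClassNonUniqueness_of_local
    (h : ∃ (T : ℝ) (v₀ : EuclideanSpace ℝ (Fin 3) → EuclideanSpace ℝ (Fin 3))
      (u v : ℝ → EuclideanSpace ℝ (Fin 3) → EuclideanSpace ℝ (Fin 3)),
      0 < T ∧ JS15Datum v₀ ∧ IsNonUniqLHPair T v₀ u v) :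
    EnergyClassNonUniqueness :=
  energyClassNonUniqueness_of_lerayHopfNonUniqueness (lerayHopfNonUniqueness_of_local_holds h)

namespace Setting

variable (S : Setting)

/-- **(A) ⇒ ns.S19, granted the published leaf only.** Jia–Šverák 2015, Thm. 5.1 (p.13) — recorded as
the field `thm51` of the HYPOTHESIS structure `JS15Leaves`, never as a fact — composed with
`lerayHopfNonUniqueness_of_local_holds`: `Setting.lerayHopfNonUniqueness_of_spectralA` without the
continuation binder. CAUTION as in `JS15Leaves`: meaningful only for the `Setting` of the actual
operator `𝓛_U`. [cite: JiaSverak2015, Thm. 5.1 p.13] -/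
theorem lerayHopfNonUniqueness_of_spectralA_of_leaves (L : S.JS15Leaves) {σ₀ δ : ℝ}
    (hA : S.SpectralA σ₀ δ) : LerayHopfNonUniqueness :=
  S.lerayHopfNonUniqueness_of_spectralA continuation_hypothesis L hA

/-- **(B) ∧ (4.5) ∧ (4.6) ⇒ ns.S19, granted the published leaf only.** Jia–Šverák 2015, Thm. 5.2
(p.13) — the field `thm52` of the HYPOTHESIS structure `JS15Leaves` — via `assembly_B` and
`lerayHopfNonUniqueness_of_local_holds`. Same CAUTION. [cite: JiaSverak2015, Thm. 5.2 p.13] -/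
theorem lerayHopfNonUniqueness_of_spectralB_of_leaves (L : S.JS15Leaves) {σ₀ δ : ℝ}
    (hB : S.SpectralB σ₀ δ) (h1 : S.ND1 σ₀) (h2 : S.ND2 σ₀) : LerayHopfNonUniqueness :=
  lerayHopfNonUniqueness_of_local_holds (S.assembly_B L hB h1 h2)

end Setting

end JiaSverak2015

/-! ### Hou–Wang–Yang families: globalisation member by member -/

namespace HouWangYang2025

variable {u₀ : EuclideanSpace ℝ (Fin 3) → EuclideanSpace ℝ (Fin 3)}
  {U : ℕ → ℝ → EuclideanSpace ℝ (Fin 3) → EuclideanSpace ℝ (Fin 3)}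

/-- **Globalisation of a Hou–Wang–Yang family.** If `(u₀, U)` is a family in the sense of
`IsNonuniqueFamily` (the object of Hou–Wang–Yang 2025, Thm. 1: members Leray–Hopf on `ℝ³ × [0, 1]`
with viscosity `1`, suitable on `(0, 1) × ℝ³`, in `L^s(0, 1; L^q)` for `2 ≤ q < ∞`, `3/q + 2/s > 1`,
pairwise distinct on `(0, 1]`), then there is a family `(u₀, W)` in the same sense ALL of whose members
are GLOBAL Leray–Hopf weak solutions from `u₀`, with `W n = U n` on `(0, 1]`. Each `W n` is the global
continuation of `U n` past `t = 1` (`IsLerayHopfOn.exists_isGlobalLerayHopf_extension`: Leray's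
existence theorem from the slice `U n 1` and concatenation — the step "it is elementary to extend the
distinct solutions to global-in-time Leray–Hopf solutions", Albritton–Brué–Colombo 2022, after
Thm. 1.2); suitability on the open slab and the mixed classes on `(0, 1)` transfer because they only
see the values on `(0, 1) × ℝ³`, where `W n` and `U n` coincide (`IsSuitableWeakSolutionOn.congr_ae`,
`MemLqLp.congr_ae_slice`), and distinctness on `(0, 1]` transfers verbatim. Nothing is asserted about
the existence of such a family. [cite: AlbrittonBrueColombo2022, remark after Thm. 1.2] -/
theorem IsNonuniqueFamily.exists_isGlobalLerayHopf_family (h : IsNonuniqueFamily u₀ U) :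
    ∃ W : ℕ → ℝ → EuclideanSpace ℝ (Fin 3) → EuclideanSpace ℝ (Fin 3),
      IsNonuniqueFamily u₀ W ∧ (∀ n, IsGlobalLerayHopf 1 0 u₀ (W n)) ∧
        ∀ n, ∀ t ∈ Ioc (0 : ℝ) 1, W n t = U n t := by
  choose W hWg hWeq using
    fun n => (h.isLerayHopfOn n).exists_isGlobalLerayHopf_extension one_pos one_pos
  refine ⟨W, ?_, hWg, hWeq⟩
  obtain ⟨hu₀, hcs, hdiv, hLq, hU, hmix, hdist⟩ := h
  refine ⟨hu₀, hcs, hdiv, hLq, fun n => ⟨hWg n 1 one_pos, ?_⟩, fun n q s hq hq' hs hqs => ?_,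
    fun m n hmn => ?_⟩
  · obtain ⟨p, hp⟩ := (hU n).2
    refine ⟨p, hp.congr_ae ?_ (ae_of_all _ fun _ => rfl)⟩
    refine ae_restrict_of_forall_mem
      (slab (EuclideanSpace ℝ (Fin 3)) (Ioo (0 : ℝ) 1) isOpen_Ioo).isOpen.measurableSet ?_
    intro z hz
    have hz1 : z.1 ∈ Ioo (0 : ℝ) 1 := mem_slab.mp hz
    simp only [uncurry]
    rw [hWeq n z.1 ⟨hz1.1, hz1.2.le⟩]
  · refine (hmix n q s hq hq' hs hqs).congr_ae_slice
      (ae_restrict_of_forall_mem measurableSet_Ioo fun t ht => ?_)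
    rw [hWeq n t ⟨ht.1, ht.2.le⟩]
  · obtain ⟨t, ht, hne⟩ := hdist m n hmn
    refine ⟨t, ht, ?_⟩
    rwa [hWeq m t ht, hWeq n t ht]

/-- **Infinitely many GLOBAL Leray–Hopf solutions from one datum, granted a Hou–Wang–Yang family**: the
members of the globalised family are global Leray–Hopf weak solutions of the unforced system (viscosity
`1`) from the common compactly supported, weakly divergence-free datum `u₀ ∈ L²(ℝ³)`, pairwise
differing at some time in `(0, 1]` on a set of positive measure — the global form of the printed
`[0, 1]`-statement of Hou–Wang–Yang 2025, Thm. 1 (projection of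
`IsNonuniqueFamily.exists_isGlobalLerayHopf_family`; nothing about existence is asserted).
[cite: AlbrittonBrueColombo2022, remark after Thm. 1.2] -/
theorem IsNonuniqueFamily.exists_global_pairwise_distinct (h : IsNonuniqueFamily u₀ U) :
    ∃ W : ℕ → ℝ → EuclideanSpace ℝ (Fin 3) → EuclideanSpace ℝ (Fin 3),
      (∀ n, IsGlobalLerayHopf 1 0 u₀ (W n)) ∧
        ∀ m n : ℕ, m ≠ n → ∃ t ∈ Ioc (0 : ℝ) 1, ¬ (W m t =ᵐ[volume] W n t) := by
  obtain ⟨W, hW, hWg, -⟩ := h.exists_isGlobalLerayHopf_family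
  exact ⟨W, hWg, hW.2.2.2.2.2.2⟩

end HouWangYang2025

end Literature.Analysis.FluidPDE
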